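import Literature.RepresentationTheory.FiniteGroups.SymmetricGroupCharacterEvaluation
import Literature.NumberTheory.DiophantineGeometry.SymmetricGroupRepsSignTwist
import HarnessLib

/-!
# Evaluation of the symmetric and exterior square character sums of the symmetric groups

Topic `Literature/RepresentationTheory/FiniteGroups`; sibling of `SymmetricGroupCharacterEvaluation.lean`
(the verified Murnaghan–Nakayama evaluator `MNEval.charValue`, `χ^λ(σ) = charValue λ n (cycle type)`,
and the class-equation evaluator `MNEval.kronSum` of Kronecker coefficients). This file adds the
COMPUTABLE, PROVED-correct evaluators of the two character sums

  `Σ_{σ ∈ 𝔖_n} χ^λ(σ) (χ^μ(σ)² + χ^μ(σ²))`  and  `Σ_{σ ∈ 𝔖_n} χ^λ(σ) (χ^μ(σ)² − χ^μ(σ²))`,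

i.e. `2·n!` times the multiplicity of `[λ]` in the symmetric square `S²[μ]`, resp. the exterior
square `Λ²[μ]`, of the Specht module `[μ]` (the characters of `S²V`, `Λ²V` being
`(χ_V(g)² ± χ_V(g²))/2`, Fulton–Harris §2.1) — `2·n!·sk(λ, μ)` and `2·n!·ak(λ, μ)` for the
"symmetric" and "skew Kronecker coefficients" of Gesmundo–Ikenmeyer–Panova (§2.1, §3), which the
barrier files `Literature/Barriers/ValiantsHypothesis/GCTMatrixPowering*.lean` render literally as
these sums (`skCharSum`, `akCharSum`):

  `MNEval.skSumT n λᵗ μ`, `MNEval.akSumT n λᵗ μ` (`sum_symSq_eq_skSumT`, `sum_extSq_eq_akSumT`).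

The first partition is passed through its TRANSPOSE `λᵗ` (`χ^λ = sgn · χ^{λᵗ}`,
`spechtCharacter_transpose`): the shapes of interest downstream have few columns, and the cost of
the Murnaghan–Nakayama recursion grows with the number of parts.

## What is proved

1. **The cycle type of the square of a permutation** (`cycleType_mul_self`): `cycleType (σ²)` is
   obtained from `cycleType σ` by keeping each odd cycle length `m`, dropping the `2`-cycles, and
   replacing each even length `m ≥ 4` by two cycles of length `m/2` (`sqCycleType`); by
   `Equiv.Perm.cycle_induction_on`, the case of one even cycle `c` of length `2k` being that every
   cycle of `c²` has length exactly `k` (`(c²)^j x = x` iff `c^{2j} = 1` iff `2k ∣ 2j`), so that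
   `cycleType (c²) = {k, k}` by counting (`cycleType_pow_two_of_isCycle_even`).
2. `χ^λ(σ) = charValue λ n ms` for ANY list `ms` enumerating the cycle type
   (`spechtCharacter_eq_charValue_of_coe_eq`, the sibling's `spechtCharacter_eq_charValue` freed of
   the sorting), hence `χ^λ(σ²) = charValue λ n (sqList ms)` (`spechtCharacter_mul_self_eq_charValue`).
3. The class equation for the two sums (`sum_symSq_eq_skSumT`, `sum_extSq_eq_akSumT`), exactly as
   for `kronSum`: group the summands by cycle type (`MNEval.cycleTypes`, `MNEval.classSize`,
   `card_filter_cycleType_eq_classSize`), with `sgn(σ) = (-1)^{Σ m + #cycles}`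
   (`Equiv.Perm.sign_of_cycleType`, `cycSign`).
4. `sortedParts_eq_of_parts_eq_coe`: a partition with an explicit decreasing list of parts has that
   list as `sortedParts`, so that one kernel computation `skSumT n C R ≠ 0` on explicit lists speaks
   about the partitions with columns `C` and parts `R`.

Closed instances reduce in the kernel by `decide` (seconds for `n ≤ 20`; for `n ≥ 24` the class sum
must be split into partial sums, as for `kronSum`). No new mathematics is claimed.

## References

* W. Fulton, J. Harris, *Representation Theory. A First Course*, GTM 129 (1991): §2.1 (characters of
  `Sym²V` and `Λ²V`), §4.1 (cycle types and class sizes), Exercise 4.51. [FultonHarrisGTM129]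
* G. James, A. Kerber, *The Representation Theory of the Symmetric Group* (1981), 1.2.15 (class
  sizes), 2.4.7 (Murnaghan–Nakayama). [JamesKerber1981]
* F. Gesmundo, C. Ikenmeyer, G. Panova, *Geometric complexity theory and matrix powering*,
  Diff. Geom. Appl. 55 (2017) 106–127 = arXiv:1611.00827, §2.1 and §3 (`sk`, `ak`).
  [GesmundoIkenmeyerPanova2017]

## Mathlib and tree

Mathlib: `Equiv.Perm.cycle_induction_on`, `Equiv.Perm.Disjoint.cycleType_mul`,
`Equiv.Perm.IsCycle.cycleType`, `Equiv.Perm.IsCycle.pow_iff`, `Equiv.Perm.IsCycle.support_pow_eq_iff`,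
`Equiv.Perm.IsCycle.pow_eq_one_iff'`, `Equiv.Perm.mem_cycleType_iff`, `Equiv.Perm.cycleOf_pow_apply_self`,
`Equiv.Perm.cycleOf_mul_of_apply_right_eq_self`, `Equiv.Perm.sum_cycleType`,
`Equiv.Perm.sign_of_cycleType`, `Nat.coprime_two_left`, `Multiset.eq_replicate`. Tree:
`MNEval.charValue`, `MNEval.mnCoeff_eq_coeff`, `MNEval.fsupp_betaList`, `MNEval.cycleTypes`,
`MNEval.classSize`, `MNEval.card_filter_cycleType_eq_classSize`, `MNEval.sort_coe_eq_of_pairwise`,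
`spechtCharacter_eq_frobeniusChar`, `frobeniusChar_eq_coeff_prod_cycleType`,
`spechtCharacter_transpose`, `Nat.Partition.transpose_transpose`.
-/

open scoped BigOperators
open Finset
open Literature.NumberTheory.DiophantineGeometry (spechtCharacter spechtCharacter_transpose)

namespace Literature.RepresentationTheory.FiniteGroups

/-! ### 1. The cycle type of the square of a permutation -/

section CycleTypeSquare

/-- The cycle type of the square of an `m`-cycle: `{m}` if `m` is odd, nothing if `m = 2`, and two
cycles of length `m / 2` if `m ≥ 4` is even. [folklore] -/
def sqCycleType (m : ℕ) : Multiset ℕ :=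
  if m % 2 = 1 then {m} else if m = 2 then 0 else {m / 2, m / 2}

variable {α : Type*} [Fintype α] [DecidableEq α]

/-- **The square of an odd cycle is a cycle of the same length.** [folklore] -/
theorem cycleType_pow_two_of_isCycle_odd {c : Equiv.Perm α} (hc : c.IsCycle)
    (hodd : c.support.card % 2 = 1) : (c ^ 2).cycleType = {c.support.card} := by
  have hord : orderOf c = c.support.card := hc.orderOf
  have hcyc : (c ^ 2).IsCycle :=
    hc.pow_iff.2 (by rw [hord]; exact Nat.coprime_two_left.2 (Nat.odd_iff.2 hodd))
  have hsupp : (c ^ 2).support = c.support := by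
    rw [hc.support_pow_eq_iff, hord]
    intro hdvd
    have h2 := Nat.le_of_dvd two_pos hdvd
    have h2' := hc.two_le_card_support
    omega
  rw [hcyc.cycleType, hsupp]

/-- **The square of a cycle of even length `2k ≥ 4` consists of two cycles of length `k`**: every
cycle of `c²` through a point `x` of the support has length `k`, because `(c²)^j x = x` iff
`c^{2j} = 1` iff `2k ∣ 2j`; and the lengths add up to `#supp(c²) = #supp(c) = 2k`. [folklore] -/
theorem cycleType_pow_two_of_isCycle_even {c : Equiv.Perm α} (hc : c.IsCycle) {k : ℕ}
    (hk : c.support.card = 2 * k) (hk2 : 2 ≤ k) : (c ^ 2).cycleType = {k, k} := by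
  have hord : orderOf c = 2 * k := by rw [hc.orderOf, hk]
  have hsupp : (c ^ 2).support = c.support := by
    rw [hc.support_pow_eq_iff, hord]
    intro hdvd
    have := Nat.le_of_dvd two_pos hdvd
    omega
  -- every cycle length of `c ^ 2` equals `k`
  have hall : ∀ m ∈ (c ^ 2).cycleType, m = k := by
    intro m hm
    obtain ⟨d, τ, hprod, hdisj, hd, rfl⟩ := Equiv.Perm.mem_cycleType_iff.1 hm
    obtain ⟨x, hdx, -⟩ := id hd
    have hτx : τ x = x := (hdisj x).resolve_left hdx
    have hx2 : (c ^ 2) x ≠ x := by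
      rw [hprod, Equiv.Perm.mul_apply, hτx]
      exact hdx
    have hcx : c x ≠ x := by
      have hmem : x ∈ (c ^ 2).support := Equiv.Perm.mem_support.2 hx2
      rw [hsupp] at hmem
      exact Equiv.Perm.mem_support.1 hmem
    have hcyc : (c ^ 2).cycleOf x = d := by
      rw [hprod, Equiv.Perm.cycleOf_mul_of_apply_right_eq_self hdisj.commute x hτx, hd.cycleOf_eq hdx]
    have hC : ((c ^ 2).cycleOf x).IsCycle := (c ^ 2).isCycle_cycleOf hx2
    have hCx : (c ^ 2).cycleOf x x ≠ x := by rwa [Equiv.Perm.cycleOf_apply_self]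
    have key : ∀ j : ℕ, (c ^ 2).cycleOf x ^ j = 1 ↔ k ∣ j := by
      intro j
      rw [hC.pow_eq_one_iff' hCx, Equiv.Perm.cycleOf_pow_apply_self, ← pow_mul,
        ← hc.pow_eq_one_iff' hcx, ← orderOf_dvd_iff_pow_eq_one, hord]
      exact Nat.mul_dvd_mul_iff_left two_pos
    have horder : orderOf ((c ^ 2).cycleOf x) = k :=
      Nat.dvd_antisymm (orderOf_dvd_of_pow_eq_one ((key k).2 dvd_rfl))
        ((key _).1 (pow_orderOf_eq_one _))
    rw [← hcyc, ← hC.orderOf, horder]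
  have hrep : (c ^ 2).cycleType = Multiset.replicate (Multiset.card (c ^ 2).cycleType) k :=
    Multiset.eq_replicate.2 ⟨rfl, hall⟩
  have hsum : Multiset.card (c ^ 2).cycleType * k = 2 * k := by
    have h := (c ^ 2).sum_cycleType
    rw [hsupp, hk] at h
    rw [hrep, Multiset.sum_replicate, smul_eq_mul] at h
    exact h
  have hcard : Multiset.card (c ^ 2).cycleType = 2 := Nat.eq_of_mul_eq_mul_right (by omega) hsum
  rw [hrep, hcard]
  rfl

/-- **The cycle type of the square of a permutation**: square each cycle separately
(`sqCycleType`; disjoint cycles commute and stay disjoint). [folklore] -/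
theorem cycleType_mul_self (σ : Equiv.Perm α) :
    (σ * σ).cycleType = σ.cycleType.bind sqCycleType := by
  induction σ using Equiv.Perm.cycle_induction_on with
  | base_one => simp
  | base_cycles c hc =>
    rw [hc.cycleType, Multiset.singleton_bind, sqCycleType, ← pow_two]
    have h2 := hc.two_le_card_support
    split_ifs with hodd h2'
    · exact cycleType_pow_two_of_isCycle_odd hc hodd
    · have h1 : c ^ 2 = 1 := by
        rw [← h2', ← hc.orderOf]
        exact pow_orderOf_eq_one c
      rw [h1, Equiv.Perm.cycleType_one]
    · obtain ⟨k, hk⟩ : ∃ k, c.support.card = 2 * k := ⟨c.support.card / 2, by omega⟩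
      rw [cycleType_pow_two_of_isCycle_even hc hk (by omega), hk, Nat.mul_div_cancel_left k two_pos]
  | induction_disjoint c τ hd _ ihc ihτ =>
    have hd2 : Equiv.Perm.Disjoint (c * c) (τ * τ) := (hd.mul_left hd).mul_right (hd.mul_left hd)
    rw [hd.commute.symm.mul_mul_mul_comm c τ, hd2.cycleType_mul, ihc, ihτ, hd.cycleType_mul,
      Multiset.add_bind]

end CycleTypeSquare

namespace MNEval

/-! ### 2. The program: cycle type of the square, sign, and the two class sums -/

section Program

/-- The (non-trivial) cycle lengths of `σ²` from those of `σ`, as lists (`coe_sqList`). [folklore] -/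
def sqList : List ℕ → List ℕ
  | [] => []
  | m :: ms =>
      if m % 2 = 1 then m :: sqList ms else if m = 2 then sqList ms else (m / 2) :: (m / 2) :: sqList ms

/-- The sign `(-1)^{Σ m + #cycles}` of a permutation from its non-trivial cycle lengths
(`Equiv.Perm.sign_of_cycleType`). [folklore] -/
def cycSign (ms : List ℕ) : ℤ :=
  (-1) ^ (ms.sum + ms.length)

/-- One class's term of the symmetric-square character sum, `#C_ρ · sgn(ρ) χ^{Lt}(ρ) (χ^M(ρ)² + χ^M(ρ²))`,
skipping the class when `χ^{Lt}(ρ) = 0`. [folklore] -/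
def skTerm (n : ℕ) (Lt M ms : List ℕ) : ℤ :=
  if charValue Lt n ms = 0 then 0 else
    (classSize n ms : ℤ) * (cycSign ms * charValue Lt n ms *
      (charValue M n ms * charValue M n ms + charValue M n (sqList ms)))

/-- One class's term of the exterior-square character sum, `#C_ρ · sgn(ρ) χ^{Lt}(ρ) (χ^M(ρ)² - χ^M(ρ²))`.
[folklore] -/
def akTerm (n : ℕ) (Lt M ms : List ℕ) : ℤ :=
  if charValue Lt n ms = 0 then 0 else
    (classSize n ms : ℤ) * (cycSign ms * charValue Lt n ms *
      (charValue M n ms * charValue M n ms - charValue M n (sqList ms)))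

/-- **The symmetric-square character sum** `Σ_{σ ∈ 𝔖_n} sgn(σ) χ^{Lt}(σ) (χ^M(σ)² + χ^M(σ²))`
`= Σ_σ χ^{λ}(σ) (χ^μ(σ)² + χ^μ(σ²)) = 2·n!·(multiplicity of [λ] in S²[μ])` for `Lt = λᵗ`, `M = μ`
(`sum_symSq_eq_skSumT`). [cite: FultonHarrisGTM129, §2.1 and Exercise 4.51] -/
def skSumT (n : ℕ) (Lt M : List ℕ) : ℤ :=
  ((cycleTypes n).map (skTerm n Lt M)).sum

/-- **The exterior-square character sum** `Σ_{σ ∈ 𝔖_n} sgn(σ) χ^{Lt}(σ) (χ^M(σ)² - χ^M(σ²))`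
`= 2·n!·(multiplicity of [λ] in Λ²[μ])` for `Lt = λᵗ`, `M = μ` (`sum_extSq_eq_akSumT`).
[cite: FultonHarrisGTM129, §2.1 and Exercise 4.51] -/
def akSumT (n : ℕ) (Lt M : List ℕ) : ℤ :=
  ((cycleTypes n).map (akTerm n Lt M)).sum

end Program

/-! ### 3. Characters at `σ²`, and the sign, from a list enumerating the cycle type -/

section Character

/-- `sqList` enumerates `bind sqCycleType`. [folklore] -/
theorem coe_sqList (ms : List ℕ) :
    (sqList ms : Multiset ℕ) = (ms : Multiset ℕ).bind sqCycleType := by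
  induction ms with
  | nil => rfl
  | cons m ms ih =>
    rw [← Multiset.cons_coe, Multiset.cons_bind, ← ih, sqList, sqCycleType]
    split_ifs <;> simp

variable {n : ℕ}

/-- `sqList` of a list enumerating the cycle type of `σ` enumerates the cycle type of `σ²`.
[folklore] -/
theorem coe_sqList_eq_cycleType_mul_self (σ : Equiv.Perm (Fin n)) {ms : List ℕ}
    (hms : (ms : Multiset ℕ) = σ.cycleType) : (sqList ms : Multiset ℕ) = (σ * σ).cycleType := by
  rw [coe_sqList, hms, cycleType_mul_self]

/-- **The evaluator computes the characters, for any enumeration of the cycle type**: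
`χ^λ(σ) = charValue λ.sortedParts n ms` whenever the list `ms` enumerates `cycleType σ` (the
sibling's `spechtCharacter_eq_charValue` is the case of the decreasing enumeration; the proof is the
same, `frobeniusChar_eq_coeff_prod_cycleType` taking any enumeration). [cite: JamesKerber1981, 2.4.7 with 2.3.15] -/
theorem spechtCharacter_eq_charValue_of_coe_eq (lam : Nat.Partition n) (σ : Equiv.Perm (Fin n))
    {ms : List ℕ} (hms : (ms : Multiset ℕ) = σ.cycleType) :
    spechtCharacter ℂ lam σ = (charValue lam.sortedParts n ms : ℂ) := by
  have hN : lam.parts.card ≤ lam.sortedParts.length := by rw [Nat.Partition.length_sortedParts]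
  rw [spechtCharacter_eq_frobeniusChar lam hN σ, frobeniusChar_eq_coeff_prod_cycleType _ σ hms,
    Fintype.card_fin, charValue, ← fsupp_betaList]
  congr 1
  symm
  refine mnCoeff_eq_coeff _ _ (length_betaList _) ?_
  have hle : ms.sum ≤ n := by
    rw [← Multiset.sum_coe, hms, Equiv.Perm.sum_cycleType]
    exact (Finset.card_le_univ _).trans (by rw [Fintype.card_fin])
  have hsumL : lam.sortedParts.sum = n := by
    rw [Nat.Partition.sortedParts, ← Multiset.sum_coe, Multiset.sort_eq, lam.parts_sum]
  rw [sum_betaList, hsumL]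
  omega

/-- **The character at the square**: `χ^λ(σ²) = charValue λ.sortedParts n (sqList ms)` for any
enumeration `ms` of `cycleType σ`. [cite: JamesKerber1981, 2.4.7] -/
theorem spechtCharacter_mul_self_eq_charValue (lam : Nat.Partition n) (σ : Equiv.Perm (Fin n))
    {ms : List ℕ} (hms : (ms : Multiset ℕ) = σ.cycleType) :
    spechtCharacter ℂ lam (σ * σ) = (charValue lam.sortedParts n (sqList ms) : ℂ) :=
  spechtCharacter_eq_charValue_of_coe_eq lam (σ * σ) (coe_sqList_eq_cycleType_mul_self σ hms)

/-- **`χ^λ = sgn · χ^{λᵗ}`** (the tree's `spechtCharacter_transpose` read from `λᵗ`).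
[cite: JamesLNM682, 6.6] -/
theorem spechtCharacter_eq_sign_mul_transpose (lam : Nat.Partition n) (σ : Equiv.Perm (Fin n)) :
    spechtCharacter ℂ lam σ = ((Equiv.Perm.sign σ : ℤ) : ℂ) * spechtCharacter ℂ lam.transpose σ := by
  conv_lhs => rw [← Nat.Partition.transpose_transpose lam]
  exact spechtCharacter_transpose ℂ lam.transpose σ

/-- The sign from an enumeration of the cycle type: `sgn(σ) = cycSign ms`. [folklore] -/
theorem sign_eq_cycSign (σ : Equiv.Perm (Fin n)) {ms : List ℕ}
    (hms : (ms : Multiset ℕ) = σ.cycleType) : ((Equiv.Perm.sign σ : ℤ) : ℂ) = (cycSign ms : ℂ) := by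
  rw [Equiv.Perm.sign_of_cycleType, ← hms, Multiset.sum_coe, Multiset.coe_card, cycSign,
    Units.val_pow_eq_pow_val, Units.val_neg, Units.val_one]

end Character

/-! ### 4. The class equation for the two sums -/

section Sums

variable {n : ℕ}

/-- The symmetric class term without the shortcut. [folklore] -/
theorem skTerm_eq (Lt M ms : List ℕ) :
    skTerm n Lt M ms = (classSize n ms : ℤ) * (cycSign ms * charValue Lt n ms *
      (charValue M n ms * charValue M n ms + charValue M n (sqList ms))) := by
  rw [skTerm]
  split_ifs with h
  · rw [h]; ring
  · rfl

/-- The exterior class term without the shortcut. [folklore] -/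
theorem akTerm_eq (Lt M ms : List ℕ) :
    akTerm n Lt M ms = (classSize n ms : ℤ) * (cycSign ms * charValue Lt n ms *
      (charValue M n ms * charValue M n ms - charValue M n (sqList ms))) := by
  rw [akTerm]
  split_ifs with h
  · rw [h]; ring
  · rfl

/-- **Regrouping a cycle-type sum by the enumeration**: for any `Φ` on cycle types and any `term`
on lists with `term l = #C_l · Φ(l)` on the enumeration, `Σ_σ Φ(cycleType σ) = Σ_{l ∈ cycleTypes n} term l`
(the bookkeeping of the sibling's `sum_spechtCharacter_mul_mul_eq_kronSum`, isolated).
[cite: FultonHarrisGTM129, §4.1 (class sizes)] -/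
theorem sum_cycleType_eq_sum_cycleTypes (Φ : Multiset ℕ → ℤ) (term : List ℕ → ℤ)
    (hterm : ∀ l ∈ cycleTypes n, term l = (classSize n l : ℤ) * Φ (l : Multiset ℕ)) :
    ∑ σ : Equiv.Perm (Fin n), ((Φ σ.cycleType : ℤ) : ℂ) = ((((cycleTypes n).map term).sum : ℤ) : ℂ) := by
  classical
  -- regroup by cycle type
  rw [Finset.sum_comp (fun m : Multiset ℕ => ((Φ m : ℤ) : ℂ)) (fun σ : Equiv.Perm (Fin n) => σ.cycleType)]
  -- enlarge the index set to the enumeration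
  set S : Finset (Multiset ℕ) := (cycleTypes n).toFinset.image (fun l : List ℕ => (l : Multiset ℕ))
    with hS
  have hsub : (univ : Finset (Equiv.Perm (Fin n))).image (fun σ => σ.cycleType) ⊆ S := by
    intro m hm
    obtain ⟨σ, -, rfl⟩ := Finset.mem_image.1 hm
    exact Finset.mem_image.2 ⟨_, List.mem_toFinset.2 (sort_cycleType_mem_cycleTypes σ),
      Multiset.sort_eq _ _⟩
  rw [Finset.sum_subset hsub (fun m _ hm => by
    have h0 : ((univ : Finset (Equiv.Perm (Fin n))).filter fun σ => σ.cycleType = m).card = 0 := by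
      rw [Finset.card_eq_zero, Finset.filter_eq_empty_iff]
      intro σ _ hσ
      exact hm (Finset.mem_image.2 ⟨σ, Finset.mem_univ _, hσ⟩)
    rw [h0, zero_smul])]
  have hinj : Set.InjOn (fun l : List ℕ => (l : Multiset ℕ)) ↑(cycleTypes n).toFinset := by
    intro l₁ h₁ l₂ h₂ h
    rw [Finset.mem_coe, List.mem_toFinset] at h₁ h₂
    have e₁ := sort_coe_eq_of_pairwise (mem_cycleTypes_iff.1 h₁).1
    have e₂ := sort_coe_eq_of_pairwise (mem_cycleTypes_iff.1 h₂).1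
    rw [← e₁, ← e₂]
    exact congrArg _ h
  rw [hS, Finset.sum_image hinj, List.sum_toFinset _ (nodup_cycleTypes n), Int.cast_list_sum,
    List.map_map]
  congr 1
  refine List.map_congr_left fun l hl => ?_
  rw [Function.comp_apply, hterm l hl, card_filter_cycleType_eq_classSize hl, nsmul_eq_mul]
  push_cast
  ring

/-- **The class equation for the symmetric-square sum**: for `λ, μ ⊢ n`,
`Σ_σ χ^λ(σ) (χ^μ(σ)² + χ^μ(σ²)) = skSumT n λᵗ.sortedParts μ.sortedParts` (as complex numbers).
[cite: FultonHarrisGTM129, §2.1 and Exercise 4.51] -/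
theorem sum_symSq_eq_skSumT (lam mu : Nat.Partition n) :
    ∑ σ : Equiv.Perm (Fin n), spechtCharacter ℂ lam σ *
        (spechtCharacter ℂ mu σ ^ 2 + spechtCharacter ℂ mu (σ * σ)) =
      (skSumT n lam.transpose.sortedParts mu.sortedParts : ℂ) := by
  set Lt := lam.transpose.sortedParts
  set M := mu.sortedParts
  set Φ : Multiset ℕ → ℤ := fun m =>
    cycSign (m.sort (· ≥ ·)) * charValue Lt n (m.sort (· ≥ ·)) *
      (charValue M n (m.sort (· ≥ ·)) * charValue M n (m.sort (· ≥ ·)) +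
        charValue M n (sqList (m.sort (· ≥ ·)))) with hΦ
  have hterm : ∀ σ : Equiv.Perm (Fin n), spechtCharacter ℂ lam σ *
      (spechtCharacter ℂ mu σ ^ 2 + spechtCharacter ℂ mu (σ * σ)) = ((Φ σ.cycleType : ℤ) : ℂ) := by
    intro σ
    have hms : ((σ.cycleType.sort (· ≥ ·) : List ℕ) : Multiset ℕ) = σ.cycleType :=
      Multiset.sort_eq _ _
    rw [spechtCharacter_eq_sign_mul_transpose lam σ, sign_eq_cycSign σ hms,
      spechtCharacter_eq_charValue_of_coe_eq lam.transpose σ hms,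
      spechtCharacter_eq_charValue_of_coe_eq mu σ hms, spechtCharacter_mul_self_eq_charValue mu σ hms,
      hΦ]
    push_cast
    ring
  simp_rw [hterm]
  rw [skSumT]
  refine sum_cycleType_eq_sum_cycleTypes Φ _ fun l hl => ?_
  rw [skTerm_eq, hΦ]
  simp only [sort_coe_eq_of_pairwise (mem_cycleTypes_iff.1 hl).1]

/-- **The class equation for the exterior-square sum**: for `λ, μ ⊢ n`,
`Σ_σ χ^λ(σ) (χ^μ(σ)² - χ^μ(σ²)) = akSumT n λᵗ.sortedParts μ.sortedParts`.
[cite: FultonHarrisGTM129, §2.1 and Exercise 4.51] -/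
theorem sum_extSq_eq_akSumT (lam mu : Nat.Partition n) :
    ∑ σ : Equiv.Perm (Fin n), spechtCharacter ℂ lam σ *
        (spechtCharacter ℂ mu σ ^ 2 - spechtCharacter ℂ mu (σ * σ)) =
      (akSumT n lam.transpose.sortedParts mu.sortedParts : ℂ) := by
  set Lt := lam.transpose.sortedParts
  set M := mu.sortedParts
  set Φ : Multiset ℕ → ℤ := fun m =>
    cycSign (m.sort (· ≥ ·)) * charValue Lt n (m.sort (· ≥ ·)) *
      (charValue M n (m.sort (· ≥ ·)) * charValue M n (m.sort (· ≥ ·)) -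
        charValue M n (sqList (m.sort (· ≥ ·)))) with hΦ
  have hterm : ∀ σ : Equiv.Perm (Fin n), spechtCharacter ℂ lam σ *
      (spechtCharacter ℂ mu σ ^ 2 - spechtCharacter ℂ mu (σ * σ)) = ((Φ σ.cycleType : ℤ) : ℂ) := by
    intro σ
    have hms : ((σ.cycleType.sort (· ≥ ·) : List ℕ) : Multiset ℕ) = σ.cycleType :=
      Multiset.sort_eq _ _
    rw [spechtCharacter_eq_sign_mul_transpose lam σ, sign_eq_cycSign σ hms,
      spechtCharacter_eq_charValue_of_coe_eq lam.transpose σ hms,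
      spechtCharacter_eq_charValue_of_coe_eq mu σ hms, spechtCharacter_mul_self_eq_charValue mu σ hms,
      hΦ]
    push_cast
    ring
  simp_rw [hterm]
  rw [akSumT]
  refine sum_cycleType_eq_sum_cycleTypes Φ _ fun l hl => ?_
  rw [akTerm_eq, hΦ]
  simp only [sort_coe_eq_of_pairwise (mem_cycleTypes_iff.1 hl).1]

end Sums

/-! ### 5. Explicit lists of parts -/

section Lists

/-- A partition whose parts are given by a decreasing list has that list as sorted parts (so that a
kernel computation on explicit lists `Lt = λᵗ.sortedParts`, `M = μ.sortedParts` applies).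
[folklore] -/
theorem sortedParts_eq_of_parts_eq_coe {d : ℕ} (mu : Nat.Partition d) {L : List ℕ}
    (hL : mu.parts = (L : Multiset ℕ)) (hsorted : L.Pairwise (· ≥ ·)) : mu.sortedParts = L := by
  change mu.parts.sort (· ≥ ·) = L
  rw [hL]
  exact sort_coe_eq_of_pairwise hsorted

end Lists

end MNEval

end Literature.RepresentationTheory.FiniteGroups
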